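import Summits.CriticalPhenomena.PercolationContinuityZ3.Theorems.PercNearOneGluingNoHeavyLowerTailFrontierDecRowsUnmarkedEdgeKeyOpen
import HarnessLib

/-!
# The root–unmarked KEY `K' = 3B₂ − 2B₃` of the increasing star: the target-split identity and the stratum where one
# target is unreachable without the edge

Support file for the Sahi programme (`--supports stmt-CriticalPhenomena-4575`, prover prim-sahi-p2 gen 6).  No definitions, no named
facts, no sorries; standard axioms.  Memo: `run/shared/lean/prim/prim-sahi/FROM-prim-sahi-p2-gen6-KEY-FIBRE.md`, `prim-sahi-p2/PROOF-E3.md` §17.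

Setting (`IncStar.incStar_nonneg_of_rootUnmarkedKey`, prim-bnk-1 gen 9): the increasing star `E₃({s↔b},{s↔c},{s↔y}) ≥ 0` on every finite
weighted graph follows from ONE inequality per root–unmarked pair `e = s(s,z)`: `0 ≤ key μ¹ μ⁰` (`K' = 3B₂ − 2B₃`), where `μ⁰ = P_{w[e↦0]}`,
`μ¹ = P_{w[e↦1]}`.  Writing `ν = μ¹`, `μ = μ⁰`, `δ = ν − μ ≥ 0` on increasing events, the KEY expands (`TerminalEdgeInduction.key_eq`) as
`K' = 2μ(ABC) + Σ_A δ_A ν(B∩C) − Σ_A ν_A μ(B∩C) + Σ_A μ_A ν_B ν_C − 2 ν_A ν_B ν_C`.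

* `key_eq_targetSplit` — the exact identity (pure algebra)
  `K' = ν_A·(ν(B∩C) − μ(B∩C)) + (ν_B − μ_B)·(ν(A∩C) − ν_A ν_C) + (ν_C − μ_C)·(ν(A∩B) − ν_A ν_B) + J_A`,
  `J_A = 2μ(A∩B∩C) − ν_B μ(A∩C) − ν_C μ(A∩B) − μ_A (ν(B∩C) − ν_B ν_C)`.
  The first three products are nonnegative for increasing events under Bernoulli percolation (monotonicity in the weight of `e` and Harris'
  inequality under `μ¹`); `J_A` vanishes as soon as `μ(A) = 0`.
* `key_open_nonneg_of_real_eq_zero` — hence `K' ≥ 0` whenever ONE of the three events is `μ⁰`-null; for the increasing star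
  (`rootEdge_key_nonneg_of_unreachable`): if some target, say `b`, cannot be joined to `s` without the pair `e = s(s,z)` (every `s–b` path of
  positive weight passes through `e`), then `K'(e) ≥ 0`, and with it both mixed Bernstein coefficients `B₁, B₂ ≥ 0` of the star along `e`
  (`rootEdge_polar_nonneg_of_unreachable`).  This is exactly the stratum `B₀ = E₃(μ⁰) = 0` on which the census infimum `K' → 0` is attained
  (ttrl2 cp-key §11: zero set `{B₀ = 0}`); there the step is Harris' inequality and nothing else.
-/

noncomputable section

namespace Summit.CriticalPhenomena.PercolationContinuityZ3.Theorems

namespace IncStar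

open MeasureTheory Literature.Probability.Percolation Literature.Probability.LatticeModels EdgeInduction TerminalEdgeInduction
open scoped Classical

variable {n : ℕ}

/-- **Target-split identity for the open-end KEY.**  For arbitrary finite measures `μ ν` and events `A B C`:
`key ν μ A B C = ν A·(ν(B∩C) − μ(B∩C)) + (ν B − μ B)(ν(A∩C) − ν A·ν C) + (ν C − μ C)(ν(A∩B) − ν A·ν B) + J_A` with
`J_A = 2μ(A∩B∩C) − ν B·μ(A∩C) − ν C·μ(A∩B) − μ A·(ν(B∩C) − ν B·ν C)`. [this work] -/
theorem key_eq_targetSplit (μ ν : Measure (BondConfig (Fin n))) (A B C : Set (BondConfig (Fin n))) :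
    key ν μ A B C =
      ν.real A * (ν.real (B ∩ C) - μ.real (B ∩ C))
      + (ν.real B - μ.real B) * (ν.real (A ∩ C) - ν.real A * ν.real C)
      + (ν.real C - μ.real C) * (ν.real (A ∩ B) - ν.real A * ν.real B)
      + (2 * μ.real (A ∩ B ∩ C) - ν.real B * μ.real (A ∩ C) - ν.real C * μ.real (A ∩ B)
          - μ.real A * (ν.real (B ∩ C) - ν.real B * ν.real C)) := by
  simp only [key, polar₁, sahiE3]
  ring

/-- **`K' ≥ 0` when the first event is `μ⁰`-null.**  For increasing events `A B C` under Bernoulli bond percolation and a pair `e`: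
if `P_{w[e↦0]}(A) = 0` then `0 ≤ key P_{w[e↦1]} P_{w[e↦0]} A B C`. [this work] -/
theorem key_open_nonneg_of_real_eq_zero (w : Sym2 (Fin n) → unitInterval) (e : Sym2 (Fin n))
    {A B C : Set (BondConfig (Fin n))} (hA : IsUpperSet A) (hB : IsUpperSet B) (hC : IsUpperSet C)
    (h0 : (prodBernoulli (Function.update w e 0)).real A = 0) :
    0 ≤ key (prodBernoulli (Function.update w e 1)) (prodBernoulli (Function.update w e 0)) A B C := by
  set μ := prodBernoulli (Function.update w e 0) with hμ
  set ν := prodBernoulli (Function.update w e 1) with hν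
  have hAC : μ.real (A ∩ C) = 0 :=
    le_antisymm (h0 ▸ measureReal_mono Set.inter_subset_left (measure_ne_top _ _)) measureReal_nonneg
  have hAB : μ.real (A ∩ B) = 0 :=
    le_antisymm (h0 ▸ measureReal_mono Set.inter_subset_left (measure_ne_top _ _)) measureReal_nonneg
  have hABC : μ.real (A ∩ B ∩ C) = 0 :=
    le_antisymm (hAB ▸ measureReal_mono Set.inter_subset_left (measure_ne_top _ _)) measureReal_nonneg
  have dBC : μ.real (B ∩ C) ≤ ν.real (B ∩ C) := tieLiftOne_real_zero_le_one w e (hB.inter hC)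
  have dB : μ.real B ≤ ν.real B := tieLiftOne_real_zero_le_one w e hB
  have dC : μ.real C ≤ ν.real C := tieLiftOne_real_zero_le_one w e hC
  have covAC : ν.real A * ν.real C ≤ ν.real (A ∩ C) :=
    prodBernoulli_harris _ hA hC MeasurableSet.of_discrete MeasurableSet.of_discrete
  have covAB : ν.real A * ν.real B ≤ ν.real (A ∩ B) :=
    prodBernoulli_harris _ hA hB MeasurableSet.of_discrete MeasurableSet.of_discrete
  have hνA : 0 ≤ ν.real A := measureReal_nonneg
  rw [key_eq_targetSplit, h0, hAC, hAB, hABC]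
  have t1 : 0 ≤ ν.real A * (ν.real (B ∩ C) - μ.real (B ∩ C)) := mul_nonneg hνA (sub_nonneg.2 dBC)
  have t2 : 0 ≤ (ν.real B - μ.real B) * (ν.real (A ∩ C) - ν.real A * ν.real C) :=
    mul_nonneg (sub_nonneg.2 dB) (sub_nonneg.2 covAC)
  have t3 : 0 ≤ (ν.real C - μ.real C) * (ν.real (A ∩ B) - ν.real A * ν.real B) :=
    mul_nonneg (sub_nonneg.2 dC) (sub_nonneg.2 covAB)
  nlinarith [t1, t2, t3]

/-- `key` is symmetric under exchanging its first two events. [this work] -/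
theorem key_comm₁₂ (μ ν : Measure (BondConfig (Fin n))) (A B C : Set (BondConfig (Fin n))) :
    key μ ν A B C = key μ ν B A C := by
  simp only [key, polar₁, sahiE3, Set.inter_comm B A]
  ring

/-- `key` is symmetric under exchanging its last two events. [this work] -/
theorem key_comm₂₃ (μ ν : Measure (BondConfig (Fin n))) (A B C : Set (BondConfig (Fin n))) :
    key μ ν A B C = key μ ν A C B := by
  simp only [key, polar₁, sahiE3]
  rw [show A ∩ C ∩ B = A ∩ B ∩ C by rw [Set.inter_assoc, Set.inter_comm C B, ← Set.inter_assoc], Set.inter_comm C B]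
  ring

/-- **The root–unmarked KEY on the stratum `B₀ = 0`.**  For the increasing star `({s↔b},{s↔c},{s↔y})` and a pair `e = s(s,z)`:
if one of the three targets cannot be joined to `s` by an open path when `e` is closed almost surely
(`P_{w[e↦0]}(s↔b) = 0`, or the same for `c` or for `y`), then `K' = key P_{w[e↦1]} P_{w[e↦0]} ≥ 0`. [this work] -/
theorem rootEdge_key_nonneg_of_unreachable (w : Sym2 (Fin n) → unitInterval) (s b c y z : Fin n)
    (h0 : (prodBernoulli (Function.update w s(s, z) 0)).real (openConn s b) = 0 ∨
          (prodBernoulli (Function.update w s(s, z) 0)).real (openConn s c) = 0 ∨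
          (prodBernoulli (Function.update w s(s, z) 0)).real (openConn s y) = 0) :
    0 ≤ key (prodBernoulli (Function.update w s(s, z) 1)) (prodBernoulli (Function.update w s(s, z) 0))
          (openConn s b) (openConn s c) (openConn s y) := by
  have ub := isUpperSet_openConn (V := Fin n) s b
  have uc := isUpperSet_openConn (V := Fin n) s c
  have uy := isUpperSet_openConn (V := Fin n) s y
  rcases h0 with hb | hc | hy
  · exact key_open_nonneg_of_real_eq_zero w _ ub uc uy hb
  · rw [key_comm₁₂]
    exact key_open_nonneg_of_real_eq_zero w _ uc ub uy hc
  · rw [key_comm₂₃, key_comm₁₂]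
    exact key_open_nonneg_of_real_eq_zero w _ uy ub uc hy

/-- **Both mixed Bernstein coefficients of the increasing star along `e = s(s,z)` are nonnegative on the stratum `B₀ = 0`**
(one target unreachable from `s` without `e`), given the increasing star under `w[e↦0]` and `w[e↦1]` (the induction hypotheses of the
root-edge schema `incStar_nonneg_of_rootUnmarkedBernstein`). [this work] -/
theorem rootEdge_polar_nonneg_of_unreachable (w : Sym2 (Fin n) → unitInterval) (s b c y z : Fin n)
    (h0 : (prodBernoulli (Function.update w s(s, z) 0)).real (openConn s b) = 0 ∨
          (prodBernoulli (Function.update w s(s, z) 0)).real (openConn s c) = 0 ∨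
          (prodBernoulli (Function.update w s(s, z) 0)).real (openConn s y) = 0)
    (ih0 : 0 ≤ sahiE3 (prodBernoulli (Function.update w s(s, z) 0)) (openConn s b) (openConn s c) (openConn s y))
    (ih1 : 0 ≤ sahiE3 (prodBernoulli (Function.update w s(s, z) 1)) (openConn s b) (openConn s c) (openConn s y)) :
    0 ≤ polar₁ (prodBernoulli (Function.update w s(s, z) 0)) (prodBernoulli (Function.update w s(s, z) 1))
          (openConn s b) (openConn s c) (openConn s y) ∧
      0 ≤ polar₁ (prodBernoulli (Function.update w s(s, z) 1)) (prodBernoulli (Function.update w s(s, z) 0))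
          (openConn s b) (openConn s c) (openConn s y) := by
  have hk := rootEdge_key_nonneg_of_unreachable w s b c y z h0
  exact ⟨polar₁_nonneg_of_key_open ih0 ih1 hk
      (pivotal_prod_nonneg_upper w s(s, z) (isUpperSet_openConn s b) (isUpperSet_openConn s c) (isUpperSet_openConn s y)),
    polar₁_swap_nonneg_of_key_open ih1 hk⟩

end IncStar

end Summit.CriticalPhenomena.PercolationContinuityZ3.Theorems
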